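import Mathlib
import Summits.Ventures.DiscreteObjects.Mahler.CensusAuxiliaryChebyshev

/-!
# The auxiliary function on a circle as rational polynomials in `w = 2 cos θ` (venture `DiscreteObjects`, target L)

Cell `pub-namedobj`, seat `pub-namedobj-mahler-g15`. Framing: lottery ticket; floor = certified bounds/negative
ranges.

On a circle `‖z‖ = r` (`r ∈ ℚ`, `r > 0`; write `z = r ω`, `‖ω‖ = 1`, `w = 2 Re ω ∈ [-2, 2]`) every ingredient of the
auxiliary function `F = auxF a qs` (`CensusAuxiliaryCuts`) is a RATIONAL POLYNOMIAL in `w`: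

* `Σ_k a_k Re(z^k + z^{-k})/2 = Σ_k a_k C_k(r + r⁻¹) C_k(w)/4`  (`cosPoly`, from `re_pow_add_inv_pow_eq_chebC`);
* `‖Q_v(z)‖² = G_{v⁺}(w)`, `‖Q_v(z⁻¹)‖² = G_{v⁻}(w)` with `v^±_i = v_i r^{±i}` (`scaleQ`) and
  `G_v(w) = λ₀(v) + Σ_{k≥1} λ_k(v) C_k(w)/2` (`gPoly`, Fejér–Riesz `normSq_vEval`), so
  `e_j log ‖q̂_j(z)‖ = (e_j/2)(log G_{v_j⁺}(w) + log G_{v_j⁻}(w))`.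

Hence a lower bound `F ≥ -m` on the circle is the ONE-VARIABLE statement `CircleClaim P gs m`:
`-m ≤ P(w) - Σ_g f_g log G_g(w)` for `w ∈ [-2, 2]` wherever all `G_g(w) > 0` (`auxF_ge_of_circleClaim`), with the explicit,
computable lists `P = cosPoly a (r + r⁻¹)` and `gs = circleLogList qs r`.  Polynomials are coefficient lists over `ℚ`
(constant term first) evaluated by Horner (`qeval`) in any division ring, so the same lists are evaluated exactly in `ℚ` by
the kernel checker (`CensusAuxCircleCheck`) and in `ℝ` in the statements.
-/

namespace Summit.Ventures.DiscreteObjects.Mahler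

open Polynomial

/-! ## Rational coefficient lists -/

/-- Horner evaluation of a rational coefficient list (constant term first) in a field. -/
def qeval {R : Type*} [Field R] : List ℚ → R → R
  | [], _ => 0
  | c :: p, x => (c : R) + x * qeval p x

/-- `qeval [] = 0`. -/
@[simp] theorem qeval_nil {R : Type*} [Field R] (x : R) : qeval [] x = 0 := rfl

/-- Horner step. -/
@[simp] theorem qeval_cons {R : Type*} [Field R] (c : ℚ) (p : List ℚ) (x : R) :
    qeval (c :: p) x = (c : R) + x * qeval p x := rfl

/-- Evaluation in `ℚ` casts to evaluation in `ℝ`. -/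
theorem qeval_cast (p : List ℚ) (x : ℚ) : ((qeval p x : ℚ) : ℝ) = qeval p (x : ℝ) := by
  induction p with
  | nil => simp
  | cons c p ih => rw [qeval_cons, qeval_cons, ← ih]; push_cast; ring

/-- Pointwise sum of coefficient lists. -/
def lAdd : List ℚ → List ℚ → List ℚ
  | [], q => q
  | p, [] => p
  | a :: p, b :: q => (a + b) :: lAdd p q

/-- `qeval (lAdd p q) = qeval p + qeval q`. -/
theorem qeval_lAdd {R : Type*} [Field R] [CharZero R] : ∀ (p q : List ℚ) (x : R),
    qeval (lAdd p q) x = qeval p x + qeval q x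
  | [], q, x => by simp [lAdd]
  | a :: p, [], x => by simp [lAdd]
  | a :: p, b :: q, x => by rw [lAdd, qeval_cons, qeval_cons, qeval_cons, qeval_lAdd p q x]; push_cast; ring

/-- Scalar multiple of a coefficient list. -/
def lSMul (c : ℚ) (p : List ℚ) : List ℚ := p.map fun a => c * a

/-- `qeval (lSMul c p) = c · qeval p`. -/
theorem qeval_lSMul {R : Type*} [Field R] [CharZero R] (c : ℚ) : ∀ (p : List ℚ) (x : R),
    qeval (lSMul c p) x = (c : R) * qeval p x
  | [], x => by simp [lSMul]
  | a :: p, x => by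
    have := qeval_lSMul c p x
    simp only [lSMul, List.map_cons, qeval_cons] at this ⊢
    rw [this]; push_cast; ring

/-- The Chebyshev polynomials `C_k` as coefficient lists: `C₀ = 2`, `C₁ = w`, `C_{k+2} = w C_{k+1} - C_k`. -/
def chebList : ℕ → List ℚ
  | 0 => [2]
  | 1 => [0, 1]
  | k + 2 => lAdd (0 :: chebList (k + 1)) (lSMul (-1) (chebList k))

/-- `qeval (chebList k) w = C_k(w)`. -/
theorem qeval_chebList {R : Type*} [Field R] [CharZero R] : ∀ (k : ℕ) (w : R),
    qeval (chebList k) w = chebC k w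
  | 0, w => by simp [chebList, chebC]
  | 1, w => by simp [chebList, chebC]
  | k + 2, w => by
    rw [chebList, qeval_lAdd, qeval_cons, qeval_lSMul, qeval_chebList (k + 1), qeval_chebList k, chebC]
    push_cast; ring

/-! ## The cosine part -/

/-- `cosPoly a u = Σ_{k<|a|} (a_k C_{k+1}(u)/4) · C_{k+1}` as a coefficient list in `w`. -/
def cosPoly (a : List ℤ) (u : ℚ) : List ℚ :=
  (List.range a.length).foldr (fun k acc => lAdd (lSMul ((a.getD k 0 : ℚ) * chebC (k + 1) u / 4) (chebList (k + 1))) acc) []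

/-- `qeval (cosPoly a u) w = Σ_k a_k C_{k+1}(u) C_{k+1}(w)/4`. -/
theorem qeval_cosPoly (a : List ℤ) (u : ℚ) (w : ℝ) :
    qeval (cosPoly a u) w = ∑ k ∈ Finset.range a.length, ((a.getD k 0 : ℤ) : ℝ) * (chebC (k + 1) (u : ℝ) * chebC (k + 1) w / 4) := by
  unfold cosPoly
  suffices H : ∀ n : ℕ, qeval ((List.range n).foldr
      (fun k acc => lAdd (lSMul ((a.getD k 0 : ℚ) * chebC (k + 1) u / 4) (chebList (k + 1))) acc) []) w =
      ∑ k ∈ Finset.range n, ((a.getD k 0 : ℤ) : ℝ) * (chebC (k + 1) (u : ℝ) * chebC (k + 1) w / 4) from H a.length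
  intro n
  induction n with
  | zero => simp
  | succ n ih =>
    rw [List.range_succ, List.foldr_append, List.foldr_cons, List.foldr_nil, Finset.sum_range_succ]
    -- the fold over `range n` with initial value `X` equals the fold with `[]` plus `X`
    have hfold : ∀ (l : List ℕ) (X : List ℚ), qeval (l.foldr
        (fun k acc => lAdd (lSMul ((a.getD k 0 : ℚ) * chebC (k + 1) u / 4) (chebList (k + 1))) acc) X) w =
        qeval (l.foldr (fun k acc => lAdd (lSMul ((a.getD k 0 : ℚ) * chebC (k + 1) u / 4) (chebList (k + 1))) acc) []) w +
          qeval X w := by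
      intro l X
      induction l with
      | nil => simp
      | cons k l ihl => rw [List.foldr_cons, List.foldr_cons, qeval_lAdd, qeval_lAdd, ihl]; ring
    rw [hfold, ih, qeval_lAdd, qeval_lSMul, qeval_chebList, qeval_nil, add_zero]
    have hc : (((a.getD n 0 : ℚ) * chebC (n + 1) u / 4 : ℚ) : ℝ) = ((a.getD n 0 : ℤ) : ℝ) * chebC (n + 1) (u : ℝ) / 4 := by
      have := map_chebC (Rat.castHom ℝ) u (n + 1)
      simp only [Rat.coe_castHom] at this
      push_cast; rw [this]
    rw [hc]; ring

/-! ## The logarithmic part -/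

/-- `v ↦ (v_0, c v_1, c² v_2, …)`: the coefficients of `Q_v(c·x)` as a polynomial in `x`. -/
def scaleQ (c : ℚ) : List ℚ → List ℚ
  | [] => []
  | a :: v => a :: (scaleQ c v).map fun b => c * b

/-- Real-coefficient version of `scaleQ`. -/
def scaleR (c : ℝ) : List ℝ → List ℝ
  | [] => []
  | a :: v => a :: (scaleR c v).map fun b => c * b

/-- `scaleQ` casts to `scaleR`. -/
theorem map_scaleQ (c : ℚ) : ∀ v : List ℚ, (scaleQ c v).map (Rat.cast : ℚ → ℝ) = scaleR (c : ℝ) (v.map (Rat.cast : ℚ → ℝ))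
  | [] => by simp [scaleQ, scaleR]
  | a :: v => by
    show ((a : ℝ) :: ((scaleQ c v).map fun b => c * b).map (Rat.cast : ℚ → ℝ)) =
      (a : ℝ) :: (scaleR (c : ℝ) (v.map (Rat.cast : ℚ → ℝ))).map fun b => (c : ℝ) * b
    rw [← map_scaleQ c v, List.map_map, List.map_map]
    congr 1
    apply List.map_congr_left
    intro b _
    simp

/-- `V_w(ω)` is linear in the coefficient list: `V_{c·w}(ω) = c V_w(ω)`. -/
theorem vEval_map_mul (c : ℝ) : ∀ (w : List ℝ) (ω : ℂ), vEval (w.map fun b => c * b) ω = (c : ℂ) * vEval w ω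
  | [], ω => by simp [vEval]
  | b :: w, ω => by rw [List.map_cons, vEval, vEval, vEval_map_mul c w ω]; push_cast; ring

/-- `V_v(c ω) = V_{scale_c v}(ω)`. -/
theorem vEval_smul (c : ℝ) : ∀ (v : List ℝ) (ω : ℂ), vEval v ((c : ℂ) * ω) = vEval (scaleR c v) ω
  | [], ω => by simp [vEval, scaleR]
  | a :: v, ω => by rw [vEval, scaleR, vEval, vEval_map_mul, vEval_smul c v ω]; ring

/-- `G_v = λ₀(v) + Σ_{k<|v|} (λ_{k+1}(v)/2) C_{k+1}` as a coefficient list in `w`. -/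
def gPoly (v : List ℚ) : List ℚ :=
  (List.range v.length).foldr (fun k acc => lAdd (lSMul (lamAt v (k + 1) / 2) (chebList (k + 1))) acc) [lamZero v]

/-- `lamZero` commutes with casting `ℚ → ℝ`. -/
theorem lamZero_map_ratCast (v : List ℚ) : lamZero (v.map (Rat.cast : ℚ → ℝ)) = ((lamZero v : ℚ) : ℝ) := by
  induction v with
  | nil => simp [lamZero]
  | cons a w ih => rw [List.map_cons, lamZero_cons, lamZero_cons, ih]; push_cast; ring

/-- `Σ (l_i m_i)` commutes with casting `ℚ → ℝ`. -/
theorem sum_zipWith_mul_ratCast (l m : List ℚ) :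
    (List.zipWith (· * ·) (l.map (Rat.cast : ℚ → ℝ)) (m.map (Rat.cast : ℚ → ℝ))).sum =
      (((List.zipWith (· * ·) l m).sum : ℚ) : ℝ) := by
  induction l generalizing m with
  | nil => simp
  | cons a l ih =>
    cases m with
    | nil => simp
    | cons b m => simp only [List.map_cons, List.zipWith_cons_cons, List.sum_cons]; rw [ih m]; push_cast; ring

/-- `lamAt` commutes with casting `ℚ → ℝ`. -/
theorem lamAt_map_ratCast (v : List ℚ) (k : ℕ) : lamAt (v.map (Rat.cast : ℚ → ℝ)) k = ((lamAt v k : ℚ) : ℝ) := by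
  unfold lamAt
  rw [← List.map_drop, sum_zipWith_mul_ratCast]; push_cast; ring

/-- `qeval (gPoly v) w = λ₀(v) + Σ_k λ_{k+1}(v) C_{k+1}(w)/2`. -/
theorem qeval_gPoly (v : List ℚ) (w : ℝ) :
    qeval (gPoly v) w = ((lamZero v : ℚ) : ℝ) + ∑ k ∈ Finset.range v.length, ((lamAt v (k + 1) : ℚ) : ℝ) * (chebC (k + 1) w / 2) := by
  unfold gPoly
  suffices H : ∀ n : ℕ, qeval ((List.range n).foldr
      (fun k acc => lAdd (lSMul (lamAt v (k + 1) / 2) (chebList (k + 1))) acc) [lamZero v]) w =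
      ((lamZero v : ℚ) : ℝ) + ∑ k ∈ Finset.range n, ((lamAt v (k + 1) : ℚ) : ℝ) * (chebC (k + 1) w / 2) from H v.length
  intro n
  induction n with
  | zero => simp
  | succ n ih =>
    rw [List.range_succ, List.foldr_append, List.foldr_cons, List.foldr_nil, Finset.sum_range_succ]
    have hfold : ∀ (l : List ℕ) (X : List ℚ), qeval (l.foldr
        (fun k acc => lAdd (lSMul (lamAt v (k + 1) / 2) (chebList (k + 1))) acc) X) w =
        qeval (l.foldr (fun k acc => lAdd (lSMul (lamAt v (k + 1) / 2) (chebList (k + 1))) acc) [lamZero v]) w +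
          qeval X w - ((lamZero v : ℚ) : ℝ) := by
      intro l X
      induction l with
      | nil => simp
      | cons k l ihl => rw [List.foldr_cons, List.foldr_cons, qeval_lAdd, qeval_lAdd, ihl]; ring
    rw [hfold, ih, qeval_lAdd, qeval_lSMul, qeval_chebList, qeval_cons, qeval_nil]
    push_cast; ring

/-- **`‖V_v(r ω)‖² = G_{scale_r v}(2 Re ω)`** on the unit circle `‖ω‖ = 1`. -/
theorem normSq_vEval_smul (v : List ℚ) (r : ℚ) {ω : ℂ} (hω : ‖ω‖ = 1) :
    Complex.normSq (vEval (v.map (Rat.cast : ℚ → ℝ)) (((r : ℝ) : ℂ) * ω)) = qeval (gPoly (scaleQ r v)) (2 * ω.re) := by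
  rw [vEval_smul, ← map_scaleQ, normSq_vEval _ hω, qeval_gPoly, lamZero_map_ratCast, List.length_map]
  congr 1
  apply Finset.sum_congr rfl
  intro k _
  rw [lamAt_map_ratCast, re_pow_unit_eq_chebC hω (k + 1)]

/-- The list of logarithmic terms on the circle `‖z‖ = r`: `(G_{v_j⁺}, e_j/2)` for all `j`, then `(G_{v_j⁻}, e_j/2)`. -/
def circleLogList (qs : List (List ℤ × ℚ)) (r : ℚ) : List (List ℚ × ℚ) :=
  qs.map (fun q => (gPoly (scaleQ r (q.1.map (Int.cast : ℤ → ℚ))), q.2 / 2)) ++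
    qs.map (fun q => (gPoly (scaleQ r⁻¹ (q.1.map (Int.cast : ℤ → ℚ))), q.2 / 2))

/-! ## The one-variable claim and the circle inequality -/

/-- The ONE-VARIABLE CLAIM certified by the kernel checker: `-m ≤ P(w) - Σ_g f_g log G_g(w)` for `w ∈ [-2, 2]` wherever all
`G_g(w) > 0`. -/
def CircleClaim (P : List ℚ) (gs : List (List ℚ × ℚ)) (m : ℚ) : Prop :=
  ∀ w : ℝ, -2 ≤ w → w ≤ 2 → (∀ g ∈ gs, 0 < qeval g.1 w) →
    -(m : ℝ) ≤ qeval P w - (gs.map fun g => ((g.2 : ℚ) : ℝ) * Real.log (qeval g.1 w)).sum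

/-- A `Finset.range` sum over `getD` is a list sum. -/
theorem sum_range_getD {α : Type*} (l : List α) (d : α) (F : α → ℝ) :
    ∑ j ∈ Finset.range l.length, F (l.getD j d) = (l.map F).sum := by
  induction l with
  | nil => simp
  | cons a l ih =>
    rw [List.length_cons, Finset.sum_range_succ', List.getD_cons_zero, List.map_cons, List.sum_cons, add_comm, ← ih]
    rfl

/-- Casting an integer vector through `ℚ` to `ℝ`. -/
theorem map_intCast_ratCast (v : List ℤ) :
    (v.map (Int.cast : ℤ → ℚ)).map (Rat.cast : ℚ → ℝ) = v.map (Int.cast : ℤ → ℝ) := by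
  rw [List.map_map]; apply List.map_congr_left; intro a _; simp

/-- **The auxiliary function on the circle `‖z‖ = r` from the one-variable claim.**  For rational `r > 0`:
`CircleClaim (cosPoly a (r + r⁻¹)) (circleLogList qs r) m` implies `-m ≤ F(z)` for `‖z‖ = r` off the zeros of the `q̂_j`. -/
theorem auxF_ge_of_circleClaim (a : List ℤ) (qs : List (List ℤ × ℚ)) {r : ℚ} (hr : 0 < r) {m : ℚ}
    (h : CircleClaim (cosPoly a (r + r⁻¹)) (circleLogList qs r) m) {z : ℂ} (hz : ‖z‖ = r)
    (hq : ∀ j < qs.length, qhat (qs.getD j ([], 0)).1 z ≠ 0) : -(m : ℝ) ≤ auxF a qs z := by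
  have hr' : (0 : ℝ) < r := by exact_mod_cast hr
  have hz0 : z ≠ 0 := by rintro rfl; rw [norm_zero] at hz; linarith
  -- polar form `z = r ω`
  set ω : ℂ := (((r : ℝ)⁻¹ : ℝ) : ℂ) * z with hω
  have hωn : ‖ω‖ = 1 := by
    rw [hω, norm_mul, Complex.norm_real, Real.norm_eq_abs, abs_of_pos (inv_pos.mpr hr'), hz, inv_mul_cancel₀ hr'.ne']
  have hzω : z = ((r : ℝ) : ℂ) * ω := by
    rw [hω, ← mul_assoc, ← Complex.ofReal_mul, mul_inv_cancel₀ hr'.ne', Complex.ofReal_one, one_mul]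
  have hzinv : z⁻¹ = (((r⁻¹ : ℚ) : ℝ) : ℂ) * (starRingEnd ℂ) ω := by
    have hωinv : ω⁻¹ = (starRingEnd ℂ) ω := by
      rw [Complex.inv_def, Complex.normSq_eq_norm_sq, hωn]; simp
    rw [hzω, mul_inv, hωinv]; push_cast; rfl
  set w : ℝ := 2 * ω.re with hw
  have hwre : 2 * (z.re / ‖z‖) = w := by
    rw [hw, hω, Complex.re_ofReal_mul, hz]; ring
  have hwb : -2 ≤ w ∧ w ≤ 2 := by
    have habs : |ω.re| ≤ ‖ω‖ := Complex.abs_re_le_norm ω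
    rw [hωn] at habs
    rw [hw]; constructor <;> [have := (abs_le.mp habs).1; have := (abs_le.mp habs).2] <;> linarith
  -- the two factors of `q̂_j`
  have hplus : ∀ v : List ℤ, ‖vEval (v.map (Int.cast : ℤ → ℝ)) z‖ ^ 2 =
      qeval (gPoly (scaleQ r (v.map (Int.cast : ℤ → ℚ)))) w := by
    intro v
    rw [← Complex.normSq_eq_norm_sq, ← map_intCast_ratCast, hzω, normSq_vEval_smul _ _ hωn]
  have hminus : ∀ v : List ℤ, ‖vEval (v.map (Int.cast : ℤ → ℝ)) z⁻¹‖ ^ 2 =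
      qeval (gPoly (scaleQ r⁻¹ (v.map (Int.cast : ℤ → ℚ)))) w := by
    intro v
    have hconj : ‖(starRingEnd ℂ) ω‖ = 1 := by rw [Complex.norm_conj, hωn]
    rw [← Complex.normSq_eq_norm_sq, ← map_intCast_ratCast, hzinv, normSq_vEval_smul _ _ hconj, Complex.conj_re]
  -- positivity of the factors
  have hpos : ∀ g ∈ circleLogList qs r, 0 < qeval g.1 w := by
    intro g hg
    unfold circleLogList at hg
    rw [List.mem_append, List.mem_map, List.mem_map] at hg
    rcases hg with ⟨q, hqmem, rfl⟩ | ⟨q, hqmem, rfl⟩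
    · obtain ⟨j, hj, hqj⟩ := List.getElem_of_mem hqmem
      have hne := hq j hj
      rw [List.getD_eq_getElem _ _ hj, hqj] at hne
      unfold qhat at hne
      have h1 : vEval (q.1.map (Int.cast : ℤ → ℝ)) z ≠ 0 := left_ne_zero_of_mul hne
      simp only
      rw [← hplus]; exact pow_pos (norm_pos_iff.mpr h1) 2
    · obtain ⟨j, hj, hqj⟩ := List.getElem_of_mem hqmem
      have hne := hq j hj
      rw [List.getD_eq_getElem _ _ hj, hqj] at hne
      unfold qhat at hne
      have h1 : vEval (q.1.map (Int.cast : ℤ → ℝ)) z⁻¹ ≠ 0 := right_ne_zero_of_mul hne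
      simp only
      rw [← hminus]; exact pow_pos (norm_pos_iff.mpr h1) 2
  have key := h w hwb.1 hwb.2 hpos
  -- identify the two sides
  have hcos : qeval (cosPoly a (r + r⁻¹)) w =
      ∑ k ∈ Finset.range a.length, ((a.getD k 0 : ℤ) : ℝ) * ((z ^ (k + 1) + z⁻¹ ^ (k + 1)).re / 2) := by
    rw [qeval_cosPoly]
    apply Finset.sum_congr rfl
    intro k _
    rw [re_pow_add_inv_pow_eq_chebC hz0 (k + 1), hwre, hz]
    push_cast; ring
  have hlog : ((circleLogList qs r).map fun g => ((g.2 : ℚ) : ℝ) * Real.log (qeval g.1 w)).sum =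
      ∑ j ∈ Finset.range qs.length, (((qs.getD j ([], 0)).2 : ℚ) : ℝ) * Real.log ‖qhat (qs.getD j ([], 0)).1 z‖ := by
    rw [sum_range_getD qs ([], 0) (fun q => ((q.2 : ℚ) : ℝ) * Real.log ‖qhat q.1 z‖)]
    unfold circleLogList
    rw [List.map_append, List.sum_append, List.map_map, List.map_map, ← List.sum_map_add]
    congr 1
    apply List.map_congr_left
    intro q hqmem
    obtain ⟨j, hj, hqj⟩ := List.getElem_of_mem hqmem
    have hne := hq j hj
    rw [List.getD_eq_getElem _ _ hj, hqj] at hne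
    unfold qhat at hne ⊢
    have h1 : 0 < ‖vEval (q.1.map (Int.cast : ℤ → ℝ)) z‖ := norm_pos_iff.mpr (left_ne_zero_of_mul hne)
    have h2 : 0 < ‖vEval (q.1.map (Int.cast : ℤ → ℝ)) z⁻¹‖ := norm_pos_iff.mpr (right_ne_zero_of_mul hne)
    simp only [Function.comp_apply]
    rw [← hplus, ← hminus, norm_mul, Real.log_mul h1.ne' h2.ne', Real.log_pow, Real.log_pow]
    push_cast; ring
  unfold auxF
  rw [← hcos, ← hlog]
  exact key

end Summit.Ventures.DiscreteObjects.Mahler
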